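/-
Copyright (c) 2026 the pub-hodgecm-mathlib formalisation cell (harness21).  Prover seat hodgecm-mathlib-LH4-p01 (g6): LH4-plan (g6) WORD #75 (P3c) «M1 LITERAL LAYER 3∕5»
(CENSUS-M1 bf2b9cff8e6aee20 §3 row #3; FINDING OF RECORD #4; design §3 (D) of F0P3a-p08 (g25)'s (P3f) census ff8e8b81cac16295, adopted by LH4-plan (g6) 14:56Z); 2026-09-02.
-/
import Literature.NumberTheory.Rogawski1990.UnitFundamentalLemmaInertFlickerRepresentatives   -- ★ the original: §1∕§2∕§4 generics REUSED by name (2-free), `exists_localRing_congr`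
import Literature.NumberTheory.Rogawski1990.FlickerTraceFramePermutation                      -- ★ F0P3a-p08 (g25): the integral conjugators `g₃ g₄` (`gThreeTrace∕gFourTrace_mul_traceTorusElt`, dets, `normTest_gThreeTrace∕gFourTrace_conj_iff`); brings ★ p851771 (`normTest_diag_conj_traceFrame_iff`) and ★ p851724 (`Q_b`, `t₁^{(b)}`, `t_π^{(b)}`)
import HarnessLib

/-!
# The four MATCHED representatives of `G′_v` over the TRACE FRAME: Flicker's `t₁, t_π, t₃, t₄` re-based on `Q_b = (1 0 1; 0 1 0; b 0 −σb)`, `b + σb = 1`, with the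
# INTEGRAL conjugators `diag(π,1,1)`, `g₃ = (πσb π π; εb 0 −ε; bσb −σb b)`, `g₄ = (πb π −π; σb 0 1; −bσb b σb)` — no `½`, no `x x̄ = 2`, no `y ȳ = −2`, no `|2| = 1`
# (Flicker 1998 §2 Prop. 3, §3; Jacobowitz 1962 §4, §7; Rogawski 1990 §3.5–§3.6, §4.3, §14.2)

Topic `NumberTheory/Rogawski1990`; namespace `Literature.NumberTheory.Rogawski1990`.  THEOREMS ONLY (no definition, no instance, no notation, no named fact, no `sorry`);
count-neutral; kernel lane `--supports stmt-HodgeConjecture-24833`.  Cell `pub/hodgecm-mathlib` (D-0151), crux H413 = `stmt-HodgeConjecture-24833`, half A line LH4 (dyadic pay-down;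
(D-UNR) PRINT by ruling D74′), LEAD T13-42 price list, FINDING OF RECORD #4 (LH4-plan (g6) WORD #55; census `F0/P3c/LH4/LH4-p01/g6/CENSUS-M1-flicker-scalars.v1.md` row #3):
the ½-free twin of ★ `UnitFundamentalLemmaInertFlickerRepresentatives` §3–§4, BYTE-PARALLEL to its conjunct list.  The original's §1 (frame∕conjugation generics), §2 (the
level-preserving congruence `ψ : G′_v ≃ₜ* U(Φ₃)(L⁺_v)` — already 2-free through ★ `…HyperbolicBasis…_of_isUnramifiedIn`) and §4 generics (`endoEmbLocal_mul_endoGL_frame`,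
`isLocalNormPair_symm_of_frames`, `not_isConj_of_normTest`) are REUSED BY NAME.  What changes: Flicker's `t₁ = P₁·diag·P₁⁻¹` (`P₁⁻¹` = the `½`-matrix) and the conjugators
`g₃, g₄` (½-entries; sign tests through `x x̄ = 2`, `y ȳ = −2`) become the trace literal `t₁^{(b)}` (★ p851724 (T3)) and the INTEGRAL conjugators of design (D) (F0P3a-p08 (g25)):
`g₃ = diag(π,1,1)·Q_b·S₂₃·diag(1,1,ε)·Q_b⁻¹ = (πσb π π; εb 0 −ε; bσb −σb b)`, `g₄ = diag(π,1,1)·Q_b·S₁₂·Q_b⁻¹ = (πb π −π; σb 0 1; −bσb b σb)` — permutation matrices `S` in the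
`Q_b`-basis — so that, EXACTLY AS IN FLICKER, `g₃·t₁^{(b)}(a,m,d) = t_π^{(b)}(a,d,m)·g₃` and `g₄·t₁^{(b)}(a,m,d) = t_π^{(b)}(m,a,d)·g₄`: the classes `t₃, t₄` are the `π`-literal ★ (T5)
with PERMUTED eigenvalues (only TWO literal shapes for the count layer), their frames `g₃·Q_b`, `g₄·Q_b` have Grams `diag(π, −π, −1)`, `diag(1, π, −π)` (the patterns `(1,1,0)`,
`(0,1,1)` of ★ p851771 `normTest_conj110_iff` ∕ `normTest_conj011_iff`, read on «`π ∉ N`, `−1 = N ε`»).  Binders of the layer: `hb : b + σb = 1`, `hσπ`, `hππ′ : π·π′ = 1`,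
`hπN : ∀ z, σz·z ≠ π`, `hε : σε·ε = −1` (supplier at the CM place: A-p12 (g28)'s `FlickerScalarsTraceCM.exists_traceFrame_scalars_of_nonsplit`, 2-free, over ★ (K1)).
HONEST READER LABEL: BANKED base layer (the consumers' re-base — census rows #7–#14 — is in flight on other hands); HC_CM is proved only modulo the 7 printed citations (2 remaining
named inputs: hLiu418 = stmt-HodgeConjecture-24832, h413 = stmt-HodgeConjecture-24833) until rung 0 closes; pays no organ, opens no road.

* (ring identities of `g₃, g₄` — the permutation trick `gᵢ·t₁^{(b)} = t_π^{(b)}(perm)·gᵢ`, the Grams `diag(π,−π,−1)` ∕ `diag(1,π,−π)` of `gᵢ·Q_b`, the dets — are ★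
  `FlickerTraceFramePermutation` (F0P3a-p08 (g25)), REUSED by name.)
* §1 `exists_trace_literals_mem_local` — the four literals `τ₁, τ_π, τ₃, τ₄ ∈ U(Φ₃)(L⁺_v)` with `Q_b, diag(π,1,1), g₃, g₄ ∈ GL₃(E_v)` and all four literal matrices (twin of ★
  `exists_flicker_literals_mem_local`; `h2` ↦ `hb`, `hε`).
* §2 **`exists_four_matched_trace_representatives`** — twin of ★ `exists_four_matched_flicker_representatives`, same conjuncts (congruence, four `IsLocalNormPair`, type-(1) frame
  `P = T̃⁻¹·Q_b`, injective norm-one eigenvalues, `ψ tᵢ = τᵢ`, the four literal matrices, the conjugators' matrices, `t₁ ≁ t₂`, `t₃ ≁ t₄` via ★ `normTest_diag_conj_traceFrame_iff` ∕ `normTest_gFourTrace_conj_iff` ∕ `normTest_gThreeTrace_conj_iff` at slot `0`).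

## References
* [Flicker1998UnitaryFL] Y. Z. Flicker, *Elementary proof of the fundamental lemma for a unitary group*, Canad. J. Math. 50 (1998), §2 Prop. 3 pp. 78–79, §3 p. 80.
* [Jacobowitz1962] R. Jacobowitz, *Hermitian forms over local fields*, Amer. J. Math. 84 (1962), §4 (4.2)–(4.4), §7 Thm. 7.1.
* [Rogawski1990] J. D. Rogawski, *Automorphic Representations of Unitary Groups in Three Variables* (1990), §3.1 p. 19, §3.5 Prop. 3.5.2 p. 29, §3.6 p. 31, §4.3 (4.3.1) p. 43,
  §14.2 p. 233.
-/

set_option autoImplicit false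

noncomputable section

open NumberField IsDedekindDomain Matrix
open scoped MatrixGroups

namespace Literature.NumberTheory.Rogawski1990

open Literature.NumberTheory.Automorphic Literature.NumberTheory.Automorphic.UnitaryGroup
open Literature.AlgebraicGeometry.ShimuraVarieties (unitaryGroup)

/-! ## §1 The four trace literals as elements of `U(Φ₃)(L⁺_v) ≤ GL₃(E_v)` -/

section Literals

variable (L : Type) [Field L] [NumberField L] [IsCMField L] {v : HeightOneSpectrum (𝓞 ↥(maximalRealSubfield L))}

/-- `(g t g⁻¹).val = M` from `g.val · t.val = M · g.val` in `GL_n`. [folklore] -/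
private theorem val_conj_eq_of_mul_eq'' {n : Type*} [Fintype n] [DecidableEq n] {R : Type*} [CommRing R] {g t : GL n R} {M : Matrix n n R}
    (h : g.val * t.val = M * g.val) : (g * t * g⁻¹).val = M := by
  rw [Units.val_mul, Units.val_mul, h, Matrix.mul_assoc, ← Units.val_mul, mul_inv_cancel, Units.val_one, Matrix.mul_one]

/-- **THE FOUR TRACE LITERALS IN `U(Φ₃)(L⁺_v)`.**  On `E_v = L ⊗ L⁺_v` at a non-split place (a field), for `b` with `b + σb = 1`, a `σ`-fixed unit `π` (`ππ′ = 1`), `ε` with `σε·ε = −1`,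
and norm-one `a, m, d`: the trace literal `t₁ = t₁^{(b)}(a,m,d)` (★ `traceTorusElt_unitary`) and its conjugates by `diag(π,1,1)`, `g₃`, `g₄` — which ARE the `π`-literals
`t_π^{(b)}(a,m,d)`, `t_π^{(b)}(a,d,m)`, `t_π^{(b)}(m,a,d)` (★ `traceTorusEltPi_unitary`; ★ `gThreeTrace∕gFourTrace_mul_traceTorusElt`) — are elements `τ₁, τ_π, τ₃, τ₄` of `U(Φ₃)(L⁺_v) = UnitaryGroup.«local» L c 3 Φ₃ v`, with
`Q_b, diag(π,1,1), g₃, g₄ ∈ GL₃(E_v)`.  Twin of ★ `exists_flicker_literals_mem_local`, `h2 : 2e = 1` REPLACED by `hb`, `hε`. [cite: Flicker1998UnitaryFL, §2 Prop. 3 pp. 78–79]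
[cite: Rogawski1990, §3.6 p. 31] -/
theorem exists_trace_literals_mem_local (w : PlacesOver L v) (hw : IsCMField.complexConj L • w.1 = w.1)
    {b π π' ε a m d : LocalRing L v} (hb : b + conjLocal L (IsCMField.complexConj L) v b = 1)
    (hσπ : conjLocal L (IsCMField.complexConj L) v π = π) (hππ : π * π' = 1) (hε : conjLocal L (IsCMField.complexConj L) v ε * ε = -1)
    (ha : conjLocal L (IsCMField.complexConj L) v a * a = 1) (hm : conjLocal L (IsCMField.complexConj L) v m * m = 1)
    (hd : conjLocal L (IsCMField.complexConj L) v d * d = 1) :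
    ∃ (τ₁ τπ τ₃ τ₄ : ↥(UnitaryGroup.«local» L (IsCMField.complexConj L) 3 (Matrix.of fun i j : Fin 3 => if i.val + j.val + 1 = 3 then (1 : L) else 0) v))
      (Q dπ g₃ g₄ : GL (Fin 3) (LocalRing L v)),
      τ₁.val.val = !![a * conjLocal L (IsCMField.complexConj L) v b + d * b, 0, a - d; 0, m, 0;
                    b * conjLocal L (IsCMField.complexConj L) v b * (a - d), 0, a * b + d * conjLocal L (IsCMField.complexConj L) v b] ∧
      τπ.val = dπ * τ₁.val * dπ⁻¹ ∧ τ₃.val = g₃ * τ₁.val * g₃⁻¹ ∧ τ₄.val = g₄ * τ₁.val * g₄⁻¹ ∧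
      Q.val = !![1, 0, 1; 0, 1, 0; b, 0, -conjLocal L (IsCMField.complexConj L) v b] ∧ dπ.val = !![π, 0, 0; 0, 1, 0; 0, 0, 1] ∧
      g₃.val = !![π * conjLocal L (IsCMField.complexConj L) v b, π, π; ε * b, 0, -ε;
                  b * conjLocal L (IsCMField.complexConj L) v b, -conjLocal L (IsCMField.complexConj L) v b, b] ∧
      g₄.val = !![π * b, π, -π; conjLocal L (IsCMField.complexConj L) v b, 0, 1;
                  -(b * conjLocal L (IsCMField.complexConj L) v b), b, conjLocal L (IsCMField.complexConj L) v b] ∧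
      τπ.val.val = !![a * conjLocal L (IsCMField.complexConj L) v b + d * b, 0, π * (a - d); 0, m, 0;
                    π' * (b * conjLocal L (IsCMField.complexConj L) v b * (a - d)), 0, a * b + d * conjLocal L (IsCMField.complexConj L) v b] ∧
      τ₃.val.val = !![a * conjLocal L (IsCMField.complexConj L) v b + m * b, 0, π * (a - m); 0, d, 0;
                    π' * (b * conjLocal L (IsCMField.complexConj L) v b * (a - m)), 0, a * b + m * conjLocal L (IsCMField.complexConj L) v b] ∧
      τ₄.val.val = !![m * conjLocal L (IsCMField.complexConj L) v b + d * b, 0, π * (m - d); 0, a, 0;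
                    π' * (b * conjLocal L (IsCMField.complexConj L) v b * (m - d)), 0, m * b + d * conjLocal L (IsCMField.complexConj L) v b] := by
  obtain ⟨α, hα0, hcα, -⟩ := cmQuadraticGenerator_spec L
  letI : Field (LocalRing L v) :=
    (Liu2021.LemD1IndexedNonVacuityNonsplitPlace.isField_localRing_of_nonsplit L v (IsCMField.complexConj L) hcα hα0 w hw).toField
  set σ := conjLocal L (IsCMField.complexConj L) v with hσ
  have hσσ : ∀ x, σ (σ x) = x := fun x => Liu2021.LemD1OfPlace.conjLocal_conjLocal_apply L v (IsCMField.complexConj L) hcα hα0 x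
  -- scalars
  have hπ0 : π ≠ 0 := fun h0 => by rw [h0, zero_mul] at hππ; exact zero_ne_one hππ
  have hε0 : ε ≠ 0 := fun h0 => by rw [h0, mul_zero] at hε; exact zero_ne_one (neg_eq_zero.1 hε.symm).symm
  have hσπ' : σ π' = π' := by
    have h1 : σ π' * π = 1 := by
      have := congrArg σ hππ
      rwa [map_mul, map_one, hσπ, mul_comm] at this
    calc σ π' = σ π' * (π * π') := by rw [hππ, mul_one]
      _ = π' := by rw [← mul_assoc, h1, one_mul]
  -- the localised form is the literal `Φ₃`
  have hΦ := adelicForm_antidiagOne_map_adeleToLocal L (v := v)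
  have hΦΦ := antidiagOne_three_mul_self (R := LocalRing L v)
  -- unitarity of the four literals (★ p851724 (T3), (T5) with permuted eigenvalues)
  have hu₁ := traceTorusElt_unitary σ hσσ hb (a := a) (m := m) (c := d) ha hm hd
  have huπ := traceTorusEltPi_unitary σ hσσ hb hππ hσπ hσπ' (a := a) (m := m) (c := d) ha hm hd
  have hu₃ := traceTorusEltPi_unitary σ hσσ hb hππ hσπ hσπ' (a := a) (m := d) (c := m) ha hd hm
  have hu₄ := traceTorusEltPi_unitary σ hσσ hb hππ hσπ hσπ' (a := m) (m := a) (c := d) hm ha hd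
  -- GL lifts
  obtain ⟨t₁, ht₁⟩ := exists_generalLinearGroup_val_eq_of_unitary σ hΦΦ hu₁
  obtain ⟨Q, hQ, -⟩ := exists_generalLinearGroup_traceFrame σ hb
  have hddπ : Matrix.det !![π, 0, 0; 0, 1, 0; 0, 0, (1 : LocalRing L v)] ≠ 0 := by
    simp [Matrix.det_fin_three]; exact hπ0
  have hdg₃ : Matrix.det !![π * σ b, π, π; ε * b, 0, -ε; b * σ b, -σ b, b] ≠ 0 := by
    rw [det_gThreeTrace_eq_neg σ hb]; exact neg_ne_zero.2 (mul_ne_zero hπ0 hε0)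
  have hdg₄ : Matrix.det !![π * b, π, -π; σ b, 0, 1; -(b * σ b), b, σ b] ≠ 0 := by
    rw [det_gFourTrace_eq_neg σ hb]; exact neg_ne_zero.2 hπ0
  set dπ := Matrix.GeneralLinearGroup.mkOfDetNeZero _ hddπ with hdπ
  set g₃ := Matrix.GeneralLinearGroup.mkOfDetNeZero _ hdg₃ with hg₃
  set g₄ := Matrix.GeneralLinearGroup.mkOfDetNeZero _ hdg₄ with hg₄
  have hdπv : dπ.val = !![π, 0, 0; 0, 1, 0; 0, 0, 1] := rfl
  have hg₃v : g₃.val = !![π * σ b, π, π; ε * b, 0, -ε; b * σ b, -σ b, b] := rfl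
  have hg₄v : g₄.val = !![π * b, π, -π; σ b, 0, 1; -(b * σ b), b, σ b] := rfl
  -- the conjugates' matrices (★ (T5) and ★ `FlickerTraceFramePermutation`)
  have hvπ : (dπ * t₁ * dπ⁻¹).val = !![a * σ b + d * b, 0, π * (a - d); 0, m, 0; π' * (b * σ b * (a - d)), 0, a * b + d * σ b] :=
    val_conj_eq_of_mul_eq'' (by rw [hdπv, ht₁]; exact diag_mul_traceTorusElt σ hππ b a m d)
  have hv₃ : (g₃ * t₁ * g₃⁻¹).val = !![a * σ b + m * b, 0, π * (a - m); 0, d, 0; π' * (b * σ b * (a - m)), 0, a * b + m * σ b] :=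
    val_conj_eq_of_mul_eq'' (by rw [hg₃v, ht₁]; exact gThreeTrace_mul_traceTorusElt σ hb hππ ε a m d)
  have hv₄ : (g₄ * t₁ * g₄⁻¹).val = !![m * σ b + d * b, 0, π * (m - d); 0, a, 0; π' * (b * σ b * (m - d)), 0, m * b + d * σ b] :=
    val_conj_eq_of_mul_eq'' (by rw [hg₄v, ht₁]; exact gFourTrace_mul_traceTorusElt σ hb hππ a m d)
  -- memberships in `U(Φ₃)(L⁺_v)`
  have hmem : ∀ {g : GL (Fin 3) (LocalRing L v)} {M : Matrix (Fin 3) (Fin 3) (LocalRing L v)}, g.val = M →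
      (M.map σ)ᵀ * (Matrix.of fun i j : Fin 3 => if i.val + j.val + 1 = 3 then (1 : LocalRing L v) else 0) * M =
        (Matrix.of fun i j : Fin 3 => if i.val + j.val + 1 = 3 then (1 : LocalRing L v) else 0) →
      g ∈ UnitaryGroup.«local» L (IsCMField.complexConj L) 3 (Matrix.of fun i j : Fin 3 => if i.val + j.val + 1 = 3 then (1 : L) else 0) v := by
    intro g M hg hM
    show g ∈ unitaryGroupOfForm σ _
    rw [mem_unitaryGroupOfForm_iff, hΦ, hg]
    exact hM
  exact ⟨⟨t₁, hmem ht₁ hu₁⟩, ⟨dπ * t₁ * dπ⁻¹, hmem hvπ huπ⟩, ⟨g₃ * t₁ * g₃⁻¹, hmem hv₃ hu₃⟩, ⟨g₄ * t₁ * g₄⁻¹, hmem hv₄ hu₄⟩,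
    Q, dπ, g₃, g₄, ht₁, rfl, rfl, rfl, hQ, hdπv, hg₃v, hg₄v, hvπ, hv₃, hv₄⟩

end Literals

/-! ## §2 THE FOUR MATCHED TRACE REPRESENTATIVES OF `G′_v` -/

section Representatives

variable (L : Type) [Field L] [NumberField L] [IsCMField L] (H' : Matrix (Fin 3) (Fin 3) L)
  {v : HeightOneSpectrum (𝓞 ↥(maximalRealSubfield L))}

/-- `![a, b, d]` is injective for pairwise distinct `a, b, d`. [folklore] -/
private theorem injective_vecThree'' {α : Type*} {a b d : α} (hab : a ≠ b) (hbd : b ≠ d) (had : a ≠ d) : Function.Injective ![a, b, d] := by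
  intro i j hij
  fin_cases i <;> fin_cases j
  all_goals first | rfl | (exfalso; revert hij; simp [hab, hbd, had, hab.symm, hbd.symm, had.symm])

/-- **THE FOUR MATCHED REPRESENTATIVES OVER THE TRACE FRAME (the G-side dictionary of the count junction, ½-free).**  At a finite place `v` of `L⁺` non-split and unramified in `L`,
of good reduction for `H′`, let `γ_H = (g, u) ∈ H_v` have a type-(1) `U(Φ₂)`-part (eigenframe `g P₂ = P₂ diag(a, d)` over `E_v`, norm-one `a ≠ d`, both `≠ u = finGammaTwo`), and let
`b, π, π′, ε ∈ E_v` be the TRACE scalars (`b + σb = 1`, `π` `σ`-fixed non-norm with `ππ′ = 1`, `σε·ε = −1`).  Then there are `t₁, t₂, t₃, t₄ ∈ G′_v = U(H′)(L⁺_v)`, ALL MATCHED WITH `γ_H`,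
with `t₁` of type (1) (eigenframe `P = T̃⁻¹·Q_b`, eigenvalues `(a, u, d)`), conjugators `g₂ = diag(π,1,1)`, `g₃`, `g₄` of the images (`ψ tᵢ = gᵢ (ψ t₁) gᵢ⁻¹`), and images under the
level-preserving congruence `ψ : G′_v ≃ₜ* U(Φ₃)(L⁺_v)` (`ψ g = T̃ g T̃⁻¹`, `ψ(K′) = K`) EQUAL TO THE TRACE LITERALS `t₁^{(b)}(a,u,d)`, `t_π^{(b)}(a,u,d)`, `t_π^{(b)}(a,d,u)`, `t_π^{(b)}(u,a,d)`;
`t₁ ≁ t₂`, `t₃ ≁ t₄` by the slot-`0` tests of ★ p851771 («`π ∉ N`»).  Twin of ★ `exists_four_matched_flicker_representatives` — binders `hb hε` replace `h2 hx hy`; NO `|2|_v = 1`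
anywhere. [cite: Flicker1998UnitaryFL, §2 Prop. 3 pp. 78–79; §3 p. 80] [cite: Jacobowitz1962, §7 Thm. 7.1] [cite: Rogawski1990, §3.6 p. 31; §4.3 (4.3.1) p. 43; §14.2 p. 233] -/
theorem exists_four_matched_trace_representatives (hH' : (H'.map (IsCMField.complexConj L))ᵀ = H')
    (w : PlacesOver L v) (hw : IsCMField.complexConj L • w.1 = w.1) (hv : Algebra.IsUnramifiedIn (𝓞 L) v.asIdeal)
    (hH'w : IsUnit (placeForm H' w.1)) (hH'i : hH'w.unit ∈ glInt 3 (w.1.adicCompletion L))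
    {γH : (cmDatum L 2 (Matrix.of fun i j : Fin 2 => if i.val + j.val + 1 = 2 then (1 : L) else 0)).Local v ×
      (cmDatum L 1 (Matrix.of fun i j : Fin 1 => if i.val + j.val + 1 = 1 then (1 : L) else 0)).Local v}
    {b π π' ε a d : LocalRing L v} (hb : b + conjLocal L (IsCMField.complexConj L) v b = 1)
    (hσπ : conjLocal L (IsCMField.complexConj L) v π = π) (hππ : π * π' = 1)
    (hπN : ∀ z : LocalRing L v, conjLocal L (IsCMField.complexConj L) v z * z ≠ π) (hε : conjLocal L (IsCMField.complexConj L) v ε * ε = -1)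
    (ha1 : conjLocal L (IsCMField.complexConj L) v a * a = 1) (hd1 : conjLocal L (IsCMField.complexConj L) v d * d = 1)
    {P₂ : GL (Fin 2) (LocalRing L v)} (hP₂ : (γH.1.val.val : Matrix (Fin 2) (Fin 2) (LocalRing L v)) * P₂.val = P₂.val * diagonal ![a, d])
    (had : a ≠ d) (hab : a ≠ finGammaTwo L v γH) (hbd : finGammaTwo L v γH ≠ d) :
    ∃ (Tl : GL (Fin 3) (LocalRing L v))
      (ψ : ↥(UnitaryGroup.«local» L (IsCMField.complexConj L) 3 H' v) ≃ₜ*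
        ↥(UnitaryGroup.«local» L (IsCMField.complexConj L) 3 (Matrix.of fun i j : Fin 3 => if i.val + j.val + 1 = 3 then (1 : L) else 0) v))
      (t₁ t₂ t₃ t₄ : (cmDatum L 3 H').Local v)
      (τ₁ τ₂ τ₃ τ₄ : ↥(UnitaryGroup.«local» L (IsCMField.complexConj L) 3 (Matrix.of fun i j : Fin 3 => if i.val + j.val + 1 = 3 then (1 : L) else 0) v))
      (P Q dπ g₃ g₄ : GL (Fin 3) (LocalRing L v)),
      -- the congruence
      formCongr (conjLocal L (IsCMField.complexConj L) v) Tl (Matrix.of fun i j : Fin 3 => if i.val + j.val + 1 = 3 then (1 : LocalRing L v) else 0) =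
          (adelicForm L 3 H').map (adeleToLocal L v) ∧
      (∀ g, (ψ g).val = Tl * g.val * Tl⁻¹) ∧ (∀ g, (ψ.symm g).val = Tl⁻¹ * g.val * Tl) ∧
      (∀ g, g ∈ cmLocalIntegralLevel L 3 H' v ↔
        ψ g ∈ cmLocalIntegralLevel L 3 (Matrix.of fun i j : Fin 3 => if i.val + j.val + 1 = 3 then (1 : L) else 0) v) ∧
      -- matching
      IsLocalNormPair L H' v γH t₁ ∧ IsLocalNormPair L H' v γH t₂ ∧ IsLocalNormPair L H' v γH t₃ ∧ IsLocalNormPair L H' v γH t₄ ∧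
      -- the type-(1) frame of `t₁`
      (t₁.val.val : Matrix (Fin 3) (Fin 3) (LocalRing L v)) * P.val = P.val * diagonal ![a, finGammaTwo L v γH, d] ∧
      Function.Injective ![a, finGammaTwo L v γH, d] ∧
      (∀ i, conjLocal L (IsCMField.complexConj L) v (![a, finGammaTwo L v γH, d] i) * ![a, finGammaTwo L v γH, d] i = 1) ∧
      P = Tl⁻¹ * Q ∧ Q.val = !![1, 0, 1; 0, 1, 0; b, 0, -conjLocal L (IsCMField.complexConj L) v b] ∧
      -- the images under `ψ`: the trace literals and their conjugators
      ψ t₁ = τ₁ ∧ ψ t₂ = τ₂ ∧ ψ t₃ = τ₃ ∧ ψ t₄ = τ₄ ∧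
      τ₁.val.val = !![a * conjLocal L (IsCMField.complexConj L) v b + d * b, 0, a - d; 0, finGammaTwo L v γH, 0;
                    b * conjLocal L (IsCMField.complexConj L) v b * (a - d), 0, a * b + d * conjLocal L (IsCMField.complexConj L) v b] ∧
      τ₂.val = dπ * τ₁.val * dπ⁻¹ ∧ τ₃.val = g₃ * τ₁.val * g₃⁻¹ ∧ τ₄.val = g₄ * τ₁.val * g₄⁻¹ ∧
      dπ.val = !![π, 0, 0; 0, 1, 0; 0, 0, 1] ∧
      g₃.val = !![π * conjLocal L (IsCMField.complexConj L) v b, π, π; ε * b, 0, -ε;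
                  b * conjLocal L (IsCMField.complexConj L) v b, -conjLocal L (IsCMField.complexConj L) v b, b] ∧
      g₄.val = !![π * b, π, -π; conjLocal L (IsCMField.complexConj L) v b, 0, 1;
                  -(b * conjLocal L (IsCMField.complexConj L) v b), b, conjLocal L (IsCMField.complexConj L) v b] ∧
      τ₂.val.val = !![a * conjLocal L (IsCMField.complexConj L) v b + d * b, 0, π * (a - d); 0, finGammaTwo L v γH, 0;
                    π' * (b * conjLocal L (IsCMField.complexConj L) v b * (a - d)), 0, a * b + d * conjLocal L (IsCMField.complexConj L) v b] ∧
      τ₃.val.val = !![a * conjLocal L (IsCMField.complexConj L) v b + finGammaTwo L v γH * b, 0, π * (a - finGammaTwo L v γH); 0, d, 0;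
                    π' * (b * conjLocal L (IsCMField.complexConj L) v b * (a - finGammaTwo L v γH)), 0,
                    a * b + finGammaTwo L v γH * conjLocal L (IsCMField.complexConj L) v b] ∧
      τ₄.val.val = !![finGammaTwo L v γH * conjLocal L (IsCMField.complexConj L) v b + d * b, 0, π * (finGammaTwo L v γH - d); 0, a, 0;
                    π' * (b * conjLocal L (IsCMField.complexConj L) v b * (finGammaTwo L v γH - d)), 0,
                    finGammaTwo L v γH * b + d * conjLocal L (IsCMField.complexConj L) v b] ∧
      -- non-conjugacy (`h12`, `h34`)
      ¬ IsConj t₁ t₂ ∧ ¬ IsConj t₃ t₄ := by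
  classical
  obtain ⟨αg, hα0, hcα, -⟩ := cmQuadraticGenerator_spec L
  letI : Field (LocalRing L v) :=
    (Liu2021.LemD1IndexedNonVacuityNonsplitPlace.isField_localRing_of_nonsplit L v (IsCMField.complexConj L) hcα hα0 w hw).toField
  have hσσ : ∀ x, conjLocal L (IsCMField.complexConj L) v (conjLocal L (IsCMField.complexConj L) v x) = x :=
    fun x => Liu2021.LemD1OfPlace.conjLocal_conjLocal_apply L v (IsCMField.complexConj L) hcα hα0 x
  have hb1 := conjLocal_finGammaTwo_mul_finGammaTwo L v γH
  -- the congruence (★ original §2), the literals (§2)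
  obtain ⟨Tl, ψ, hform, hψ, hψs, hlev⟩ := exists_localRing_congr L H' hH' w hw hv hH'w hH'i
  obtain ⟨τ₁, τπ, τ₃, τ₄, Q, dπ, g₃, g₄, hτ₁, hτπ, hτ₃, hτ₄, hQ, hdπ, hg₃, hg₄, hvπ, hv₃, hv₄⟩ :=
    exists_trace_literals_mem_local L w hw (a := a) (m := finGammaTwo L v γH) (d := d) hb hσπ hππ hε ha1 hb1 hd1
  -- eigenframes
  have hau : IsUnit a := IsUnit.of_mul_eq_one_right _ ha1
  have hdu : IsUnit d := IsUnit.of_mul_eq_one_right _ hd1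
  have hdDa : Matrix.det (diagonal ![a, d]) ≠ 0 := by
    rw [det_diagonal, Fin.prod_univ_two]
    exact mul_ne_zero hau.ne_zero hdu.ne_zero
  have hXframe := endoEmbLocal_mul_endoGL_frame L (γH := γH) (P₂ := P₂) (Da := Matrix.GeneralLinearGroup.mkOfDetNeZero _ hdDa) rfl hP₂
  have hτframe : τ₁.val.val * Q.val = Q.val * diagonal ![a, finGammaTwo L v γH, d] := by
    rw [hτ₁, hQ, traceTorusElt_mul_frame _ hb, etaDiag_eq_diagonal]
  have h1τ₁ : τ₁.val = 1 * τ₁.val * 1⁻¹ := by rw [one_mul, inv_one, mul_one]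
  -- non-conjugacy in `U(Φ₃)(L⁺_v)` from one slot-`0` test each (★ p851771 ∕ ★ `FlickerTraceFramePermutation`), pulled back along `ψ`
  have n12 : ¬ IsConj τ₁ τπ :=
    not_isConj_of_normTest L w hw ha1 hb1 hd1 hab hbd had hτframe h1τ₁ hτπ 0
      ((normTest_one_conj_iff (conjLocal L (IsCMField.complexConj L) v) Q 0).2 rfl)
      (fun h => absurd ((normTest_diag_conj_traceFrame_iff (conjLocal L (IsCMField.complexConj L) v) hσσ hb hσπ hπN hQ hdπ 0).1 h) (by decide))
  have n43 : ¬ IsConj τ₄ τ₃ :=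
    not_isConj_of_normTest L w hw ha1 hb1 hd1 hab hbd had hτframe hτ₄ hτ₃ 0
      ((normTest_gFourTrace_conj_iff (conjLocal L (IsCMField.complexConj L) v) hσσ hb hσπ hπN hQ hg₄ 0).2 rfl)
      (fun h => absurd ((normTest_gThreeTrace_conj_iff (conjLocal L (IsCMField.complexConj L) v) hσσ hb hσπ hπN hε hQ hg₃ 0).1 h) (by decide))
  have pull : ∀ {σ₁ σ₂ : ↥(UnitaryGroup.«local» L (IsCMField.complexConj L) 3 (Matrix.of fun i j : Fin 3 => if i.val + j.val + 1 = 3 then (1 : L) else 0) v)},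
      ¬ IsConj σ₁ σ₂ → ¬ IsConj (ψ.symm σ₁) (ψ.symm σ₂) := by
    intro σ₁ σ₂ hn hc
    have h : IsConj (ψ (ψ.symm σ₁)) (ψ (ψ.symm σ₂)) := MonoidHom.map_isConj ψ.toMulEquiv.toMonoidHom hc
    rw [ContinuousMulEquiv.apply_symm_apply, ContinuousMulEquiv.apply_symm_apply] at h
    exact hn h
  -- the representatives
  refine ⟨Tl, ψ, ψ.symm τ₁, ψ.symm τπ, ψ.symm τ₃, ψ.symm τ₄, τ₁, τπ, τ₃, τ₄, Tl⁻¹ * Q, Q, dπ, g₃, g₄,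
    hform, hψ, hψs, hlev,
    isLocalNormPair_symm_of_frames L H' ψ hψs hXframe hτframe h1τ₁, isLocalNormPair_symm_of_frames L H' ψ hψs hXframe hτframe hτπ,
    isLocalNormPair_symm_of_frames L H' ψ hψs hXframe hτframe hτ₃, isLocalNormPair_symm_of_frames L H' ψ hψs hXframe hτframe hτ₄,
    ?_, injective_vecThree'' hab hbd had, ?_, rfl, hQ,
    ψ.apply_symm_apply τ₁, ψ.apply_symm_apply τπ, ψ.apply_symm_apply τ₃, ψ.apply_symm_apply τ₄,
    hτ₁, hτπ, hτ₃, hτ₄, hdπ, hg₃, hg₄, hvπ, hv₃, hv₄,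
    pull n12, pull (fun h => n43 h.symm)⟩
  · -- frame of `t₁ = Tl⁻¹ τ₁ Tl`
    have h := conj_mul_frame_eq (g := Tl⁻¹) hτframe
    rw [inv_inv] at h
    rw [hψs τ₁, Units.val_mul]
    exact h
  · intro i
    fin_cases i
    · exact ha1
    · exact hb1
    · exact hd1

end Representatives

end Literature.NumberTheory.Rogawski1990

end
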